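import Mathlib
import HarnessLib
import Summits.HubbardSuperconductivity.HubbardSuperconductivity.Theorems.KLProgrammeH10TwoPointLimitKlAnisoTightBundleBricks

/-!
# Route `KLProgramme` — K3 engine (stmt-HubbardSuperconductivity-20437), stub (b) (ℓ)/(I2), located item «ON-CLASS-KB» (K′): bricks for the
# narrow (double-cone) count (`…KlAnisoNarrowConeCount`)

Cell gate-hubbard-kl, seat p4 g13.  Elementary bricks, all PROVED, no definitions, no named facts:
* `torusDist_zero_eq` — `‖0‖_{𝕋¹} = 0`;
* `exists_sign_apply_centre_of_two_pow_dvd` — cone reduction: `2^k ∣ (a − b − D)` ⇒ for a centrally symmetric torus-Lipschitz centre map `P`,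
  `P(centre_k a) = z·P(centre_k b) + O(Lip·|D|·w_k)` coordinatewise with a sign `z = ±1` (the centre of `a` is the centre of `b` shifted by `D·w_k`
  plus a multiple of `π`; even multiples are invisible to a torus-Lipschitz map, odd ones flip the sign);
* `int_mul_polar_eq` — `n·(r e⃗(θ)) = (|n| r)·e⃗(θ + s)` with `s ∈ {0, π}`.
Nothing here asserts anything about the model or superconductivity. [folklore]
-/

noncomputable section

namespace Summit.HubbardSuperconductivity.HubbardSuperconductivity.Theorems.PerturbedFermiCurve

set_option linter.dupNamespace false -- summit = problem name (single-conjunct summit), D-0017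

open Classical
open Real Set Finset
open Literature.MathematicalPhysics.QuantumLattice Literature.MathematicalPhysics.QuantumLattice.BandSectorCounting
open Literature.MathematicalPhysics.QuantumLattice.FermiRG Literature.MathematicalPhysics.QuantumLattice.FermiRG.BGM2003

/-! ## §1 Two bricks -/

/-- `torusDist 0 = 0`. -/
theorem torusDist_zero_eq : FermiRG.torusDist 0 = 0 :=
  le_antisymm ((torusDist_le_abs_self 0).trans (by simp)) (torusDist_nonneg_self 0)

/-- **Cone reduction.**  If `2^k ∣ (a − b − D)` then the centre of sector `a` is the centre of sector `b` shifted by `D·w_k` plus a multiple of `π`, so for a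
centrally symmetric torus-Lipschitz centre map `P`: `P(centre a) = z·P(centre b) + O(Lip·|D|·w_k)` coordinatewise with a sign `z = ±1`. [folklore] -/
theorem exists_sign_apply_centre_of_two_pow_dvd (P : ℝ → (Fin 2 → ℝ)) {Lip : ℝ} (hLip0 : 0 ≤ Lip) (hanti : ∀ θ, P (θ + π) = -P θ)
    (hLip : ∀ θ θ' : ℝ, ∀ j : Fin 2, |P θ j - P θ' j| ≤ Lip * FermiRG.torusDist (θ - θ')) {k a b : ℕ} {D : ℤ}
    (h : ((2 : ℤ) ^ k) ∣ ((a : ℤ) - b - D)) :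
    ∃ z : ℤ, (z = 1 ∨ z = -1) ∧ ∀ j : Fin 2, |P (sectorCenter k a) j - (z : ℝ) * P (sectorCenter k b) j| ≤ Lip * (|(D : ℝ)| * sectorWidth k) := by
  obtain ⟨q, hq⟩ := h
  have hw := sectorWidth_pos k
  have hπk : (2 : ℝ) ^ k * sectorWidth k = π := by
    have h1 := sectorCount_mul_sectorWidth k
    have : (sectorCount k : ℝ) = 2 * 2 ^ k := by unfold sectorCount; push_cast; ring
    rw [this] at h1; linarith
  have hab : (a : ℝ) - b = D + 2 ^ k * q := by
    have : ((a : ℤ) : ℝ) - ((b : ℤ) : ℝ) - (D : ℝ) = (((2 : ℤ) ^ k * q : ℤ) : ℝ) := by rw [← hq]; push_cast; ring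
    push_cast at this; linarith
  have hcen : sectorCenter k a = sectorCenter k b + D * sectorWidth k + q * π := by
    rw [BandSectorCounting.sectorCenter_eq, BandSectorCounting.sectorCenter_eq, ← hπk]
    have : (a : ℝ) = b + D + 2 ^ k * q := by linarith
    rw [this]; ring
  -- the `O(Lip·|D|·w)` step at the base angle
  have hbase : ∀ j : Fin 2, |P (sectorCenter k b + D * sectorWidth k) j - P (sectorCenter k b) j| ≤ Lip * (|(D : ℝ)| * sectorWidth k) := by
    intro j
    calc |P (sectorCenter k b + D * sectorWidth k) j - P (sectorCenter k b) j|
        ≤ Lip * FermiRG.torusDist (sectorCenter k b + D * sectorWidth k - sectorCenter k b) := hLip _ _ j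
      _ ≤ Lip * (|(D : ℝ)| * sectorWidth k) := by
          apply mul_le_mul_of_nonneg_left _ hLip0
          have e : sectorCenter k b + D * sectorWidth k - sectorCenter k b = D * sectorWidth k := by ring
          rw [e]
          calc FermiRG.torusDist (D * sectorWidth k) ≤ |(D : ℝ) * sectorWidth k| := torusDist_le_abs_self _
            _ = |(D : ℝ)| * sectorWidth k := by rw [abs_mul, abs_of_pos hw]
  -- exact transport along multiples of `2π`: torus-Lipschitz maps are `2π`-periodic
  have hper : ∀ θ : ℝ, ∀ r : ℤ, ∀ j : Fin 2, P (θ + r * (2 * π)) j = P θ j := by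
    intro θ r j
    have h1 := hLip (θ + r * (2 * π)) θ j
    have e : θ + r * (2 * π) - θ = 0 + r * (2 * π) := by ring
    rw [e, torusDist_add_int_mul_two_pi, torusDist_zero_eq, mul_zero] at h1
    have : |P (θ + r * (2 * π)) j - P θ j| = 0 := le_antisymm h1 (abs_nonneg _)
    rwa [abs_eq_zero, sub_eq_zero] at this
  rcases Int.even_or_odd' q with ⟨r, hr | hr⟩
  · refine ⟨1, Or.inl rfl, fun j => ?_⟩
    have e : sectorCenter k a = (sectorCenter k b + D * sectorWidth k) + r * (2 * π) := by
      rw [hcen, hr]; push_cast; ring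
    rw [e, hper, Int.cast_one, one_mul]
    exact hbase j
  · refine ⟨-1, Or.inr rfl, fun j => ?_⟩
    have e : sectorCenter k a = (sectorCenter k b + D * sectorWidth k + π) + r * (2 * π) := by
      rw [hcen, hr]; push_cast; ring
    rw [e, hper, hanti, Pi.neg_apply, Int.cast_neg, Int.cast_one, neg_one_mul, ← abs_neg]
    have e2 : -(-P (sectorCenter k b + D * sectorWidth k) j - -P (sectorCenter k b) j) =
        P (sectorCenter k b + D * sectorWidth k) j - P (sectorCenter k b) j := by ring
    rw [e2]; exact hbase j

/-- `n·(r cos θ, r sin θ) = (|n|·r)·(cos(θ+s), sin(θ+s))` with `s = 0` (`n ≥ 0`) or `s = π` (`n < 0`). -/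
theorem int_mul_polar_eq (n : ℤ) (r θ : ℝ) : ∃ s : ℝ, (s = 0 ∨ s = π) ∧
    (n : ℝ) * (r * Real.cos θ) = (|(n : ℝ)| * r) * Real.cos (θ + s) ∧ (n : ℝ) * (r * Real.sin θ) = (|(n : ℝ)| * r) * Real.sin (θ + s) := by
  by_cases hn : (n : ℝ) < 0
  · refine ⟨π, Or.inr rfl, ?_, ?_⟩
    · rw [Real.cos_add_pi, abs_of_neg hn]; ring
    · rw [Real.sin_add_pi, abs_of_neg hn]; ring
  · refine ⟨0, Or.inl rfl, ?_, ?_⟩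
    · rw [add_zero, abs_of_nonneg (not_lt.1 hn)]; ring
    · rw [add_zero, abs_of_nonneg (not_lt.1 hn)]; ring

end Summit.HubbardSuperconductivity.HubbardSuperconductivity.Theorems.PerturbedFermiCurve

end
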